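import Literature.Combinatorics.Additive.GlobalLevelInequality
import HarnessLib

/-!
# The level-`d` inequality for biglobal FUNCTIONS on the symmetric group (Keevash–Lifshitz 2023, Theorem 3.1)

Source: P. Keevash, N. Lifshitz, *Sharp hypercontractivity for symmetric groups and its applications*,
arXiv:2307.15030 (bib key `KeevashLifshitz2023`), Definition 1.4 (restrictions, globalness and biglobalness
of a FUNCTION, stated uniformly for `L²(S_n)` and `L²([n]^n)`) and §3 **Theorem 3.1** — the paper's general
level-`d` inequality, of which the set version Theorem 1.8 (the tree's named fact
`Literature.Combinatorics.Additive.KeevashLifshitz.GlobalLevelDInequality`, module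
`Literature/Combinatorics/Additive/GlobalLevelInequality.lean`) "is a special case" (p. 17, first paragraph of
§3; held text `paper:arxiv-2307.15030`, chunks p0004, p0005, p0011, p0017 read first-hand 2026-08-27).

* `IsBiglobal r γ₁ γ₂ d f` — **Def. 1.4** for `f : S_n → ℝ`: "`f` is `(r, γ₁, γ₂, d)`-biglobal if
  `‖f_*‖₁ ≤ r^t γ₁` and `‖f_*‖₂ ≤ r^t γ₂` for all `t`-restrictions `f_*` of `f` with `t ≤ d`", where a
  `t`-restriction is `f_{I→J} ∈ L²(U_{I→J}, μ)`, the restriction of `f` to the `t`-umvirate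
  `U_{I→J} = {σ : σ ∘ I = J}` of two `t`-tuples of DISTINCT elements (`I, J ∈ [n]_t`, p. 4), normed with the
  uniform measure on the umvirate (p. 4: "`μ` also denotes uniform measure on `U_{I→J}`"). Written with
  cleared denominators: `Σ_{σ ∈ U} |f σ| ≤ r^t γ₁ |U|` and `Σ_{σ ∈ U} (f σ)² ≤ (r^t γ₂)² |U|` (equivalent:
  `|U_{I→J}| = (n − t)! > 0` for injective data);
* `GlobalLevelDInequalityBiglobal` — **Theorem 3.1** (first clause) as a NAMED FACT (`def … : Prop`, not
  proved here — the proof is the paper's §3: Lemma 3.6 from the Keller–Lifshitz–Marcus level-`d` inequality on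
  `[n]^n` through the coupling `T_C`, then `⟨T_d f, f⟩ ≥ 3^{−d} ‖f^{=d}‖₂²`; the same engine as Theorem 1.8):
  "Let `f ∈ L²(S_n)` be `(r, γ₁, γ₂, d)`-biglobal with `r > 1`, `γ₂ > γ₁ > 0` and
  `d ≤ min(¼ log(γ₂/γ₁), 10⁻⁵ n)`. Then `‖f^{=d}‖₂² ≤ γ₁² (10⁶ r² d⁻¹ log(γ₂/γ₁))^d`." Transcribed verbatim
  with the expectation norm `‖f^{=d}‖₂² = ‖levelPart n d (vec f)‖²/n!` (as in the Theorem 1.8 module),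
  `log = Real.log`, `d⁻¹ = 1/d` (at `d = 0` the printed right side is `γ₁²·x⁰ = γ₁²` whatever `x` is, and so is
  ours), and the EXPLICIT constant `10⁶` of print;
* PROVED, for consumers (cell pnp-psdrank, rung F-N2, route `ChebyshevTracialDesign`, crux stmt-PneNP-19878;
  prover MEMO-12 §3 (2): the matching-side level-`k` inequality «(F2)» is needed for `[−1,1]`-WEIGHTED
  homogeneous families, `y(M) = Y_M[q,p]` the entries of a contraction, whereas the tree's
  `HomogeneousMatchingFamilies.pmatch_closedSum_sq_le` and the fact `GlobalLevelDInequality` are for indicator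
  SETS only; lit memo LIT-20):
  - `IsBiglobal.mono` (larger `r ≥ 0`, smaller `d`);
  - **`isBiglobal_indicator_mul`**: if `A ⊆ S_n` is `r`-global (Def. 1.6, tree `IsGlobal r A`:
    `μ_U(A) ≤ r^{2t} μ(A)`) with `r² ≥ 1`, then for EVERY `y : S_n → [−1,1]` the function `y·1_A` is
    `(r², μ(A), √μ(A), d)`-biglobal for every `d` — the parameters of the SET, uniformly in the weight
    (`‖(y1_A)_U‖₁ ≤ μ_U(A)`, `‖(y1_A)_U‖₂² ≤ μ_U(A)`);
  - `one_le_sq_of_isGlobal` (`r² ≥ 1` is automatic for a nonempty global set: average over the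
    `1`-umvirates `U_{i→j}`, `j ∈ [n]`);
  - **`GlobalLevelDInequality_of_biglobal : GlobalLevelDInequalityBiglobal → GlobalLevelDInequality`** with
    the constant `C = 2·10⁶` — Theorem 1.8 IS the special case `y ≡ 1`, `γ₁ = μ(A)`, `γ₂ = √μ(A)`
    (`¼ log(γ₂/γ₁) = ⅛ log(1/μ(A))`; parameter `r² + 1 > 1`, `(r² + 1)² ≤ 4r⁴`), so every consumer
    `(hKL : GlobalLevelDInequality)` of the cell can be fed from the wider root without loss;
  - the variational ("dual") readings `GlobalLevelDInequalityBiglobal.dual` (generic biglobal `f` against a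
    pure degree-`d` test vector `g`: `(Σ_σ f σ · g σ)² ≤ ‖g‖² · n! · γ₁² (10⁶ r² d⁻¹ log(γ₂/γ₁))^d`) and
    **`GlobalLevelDInequalityBiglobal.dual_indicator_mul`** (`(Σ_{σ ∈ A} y σ · g σ)² ≤
    ‖g‖² · n! · μ(A)² (2·10⁶ r⁴ d⁻¹ log(1/μ(A)))^d` for `r`-global `A`, `|y| ≤ 1`, `1 ≤ d ≤ min(⅛ log(1/μ(A)), 10⁻⁵ n)`)
    — the drop-in weighted twin of `GlobalLevelDInequality.dual`, consumed by
    `Literature/Combinatorics/AssociationSchemes/MatchingLevelInequalityWeighted.lean`.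

Debt note (D-0026): ONE new named fact, the paper's main level-`d` theorem; it formally implies the tree's
existing fact (proved below), so the conditional basis of its consumers is in substance unchanged (one preprint
theorem of Keevash–Lifshitz 2023, §3). Publication status as recorded in the Theorem 1.8 module (arXiv preprint;
the set version restated as Keller–Lifshitz–Sheinfeld 2024 Thm 4.1); whether a published paper restates the
function form was not checked. WHAT THIS IS NOT: not a proof of Theorem 3.1 or 1.8; nothing about matchings or
psd rank; no P-vs-NP content.
-/

noncomputable section

namespace Literature.Combinatorics.Additive.KeevashLifshitz

open Finset
open scoped InnerProductSpace

variable {n : ℕ}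

/-! ## Def. 1.4: biglobal functions -/

/-- **`(r, γ₁, γ₂, d)`-biglobal function** (Keevash–Lifshitz, arXiv:2307.15030, **Def. 1.4**, for
`f ∈ L²(S_n)`): for every `t ≤ d` and all `t`-tuples of distinct elements `I, J` (injective
`I J : Fin t → Fin n`), the restriction `f_{I→J}` of `f` to the umvirate `U_{I→J}` has
`‖f_{I→J}‖₁ ≤ r^t γ₁` and `‖f_{I→J}‖₂ ≤ r^t γ₂` in the uniform measure on `U_{I→J}`; with cleared
denominators: `Σ_{σ ∈ U_{I→J}} |f σ| ≤ r^t γ₁ |U_{I→J}|` and `Σ_{σ ∈ U_{I→J}} (f σ)² ≤ (r^t γ₂)² |U_{I→J}|`.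
[cite: KeevashLifshitz2023, Def. 1.4] -/
def IsBiglobal (r γ₁ γ₂ : ℝ) (d : ℕ) (f : Equiv.Perm (Fin n) → ℝ) : Prop :=
  ∀ t : ℕ, t ≤ d → ∀ I J : Fin t → Fin n, Function.Injective I → Function.Injective J →
    (∑ σ ∈ umvirate I J, |f σ|) ≤ r ^ t * γ₁ * ((umvirate I J).card : ℝ) ∧
    (∑ σ ∈ umvirate I J, f σ ^ 2) ≤ (r ^ t * γ₂) ^ 2 * ((umvirate I J).card : ℝ)

/-- Monotonicity of biglobalness: a larger parameter `r' ≥ r ≥ 0` and a smaller depth `d' ≤ d` are weaker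
requirements (for `γ₁, γ₂ ≥ 0`). [cite: KeevashLifshitz2023, Def. 1.4] -/
theorem IsBiglobal.mono {r r' γ₁ γ₂ : ℝ} {d d' : ℕ} {f : Equiv.Perm (Fin n) → ℝ}
    (h : IsBiglobal r γ₁ γ₂ d f) (hr : 0 ≤ r) (hrr' : r ≤ r') (hγ₁ : 0 ≤ γ₁) (hγ₂ : 0 ≤ γ₂) (hd : d' ≤ d) :
    IsBiglobal r' γ₁ γ₂ d' f := by
  intro t ht I J hI hJ
  obtain ⟨h1, h2⟩ := h t (ht.trans hd) I J hI hJ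
  have hpow : r ^ t ≤ r' ^ t := pow_le_pow_left₀ hr hrr' t
  have hU : (0 : ℝ) ≤ ((umvirate I J).card : ℝ) := by positivity
  refine ⟨h1.trans ?_, h2.trans ?_⟩
  · exact mul_le_mul_of_nonneg_right (mul_le_mul_of_nonneg_right hpow hγ₁) hU
  · have h0 : 0 ≤ r ^ t * γ₂ := mul_nonneg (pow_nonneg hr t) hγ₂
    exact mul_le_mul_of_nonneg_right (pow_le_pow_left₀ h0 (mul_le_mul_of_nonneg_right hpow hγ₂) 2) hU

/-! ## Theorem 3.1 (named fact) -/

/-- **Level-`d` inequality for biglobal functions on `S_n`** — Keevash–Lifshitz, arXiv:2307.15030,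
**Theorem 3.1** (first clause): "Let `f ∈ L²(S_n)` be `(r, γ₁, γ₂, d)`-biglobal with `r > 1`, `γ₂ > γ₁ > 0`
and `d ≤ min(¼ log(γ₂/γ₁), 10⁻⁵ n)`. Then `‖f^{=d}‖₂² ≤ γ₁² (10⁶ r² d⁻¹ log(γ₂/γ₁))^d`."
Here `‖f^{=d}‖₂² = ‖levelPart n d (vec f)‖²/n!` (expectation norm; `levelPart`, `vec` from the Theorem 1.8
module), `IsBiglobal` is Def. 1.4, `log = Real.log`, `d⁻¹ = 1/d`, and the constant `10⁶` is the printed one.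
NAMED FACT, not proved in the tree (proof: the paper's §3, Lemma 3.6 + the coupling argument, resting on the
Keller–Lifshitz–Marcus level-`d` inequality for global functions on product spaces). The paper notes that
Theorem 1.8 (the tree's `GlobalLevelDInequality`) is its special case; `GlobalLevelDInequality_of_biglobal`
below proves that implication. Source status: arXiv preprint (2023).
[cite: KeevashLifshitz2023, Thm. 3.1] -/
def GlobalLevelDInequalityBiglobal : Prop :=
  ∀ (n : ℕ) (f : Equiv.Perm (Fin n) → ℝ) (r γ₁ γ₂ : ℝ) (d : ℕ),
    1 < r → 0 < γ₁ → γ₁ < γ₂ → IsBiglobal r γ₁ γ₂ d f →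
    (d : ℝ) ≤ Real.log (γ₂ / γ₁) / 4 → (d : ℝ) ≤ (n : ℝ) / 10 ^ 5 →
    ‖levelPart n d (vec f)‖ ^ 2 / n.factorial ≤
      γ₁ ^ 2 * (10 ^ 6 * r ^ 2 * (1 / (d : ℝ)) * Real.log (γ₂ / γ₁)) ^ d

/-- `⟪vec f, g⟫ = Σ_σ f σ · g σ`. [cite: KeevashLifshitz2023, §1.2 (p. 4)] -/
theorem inner_vec_left (f : Equiv.Perm (Fin n) → ℝ) (g : SnSpace n) :
    ⟪vec f, g⟫_ℝ = ∑ σ, f σ * g σ := by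
  rw [inner_eq_sum]
  rfl

/-- **Consumer form of Theorem 3.1**: for `(r, γ₁, γ₂, d)`-biglobal `f` (`r > 1`, `γ₂ > γ₁ > 0`),
`1 ≤ d ≤ min(¼ log(γ₂/γ₁), 10⁻⁵ n)` and every `g ∈ V_{≤ d}` orthogonal to `V_{≤ d−1}`,
`(Σ_σ f σ · g σ)² ≤ ‖g‖² · n! · γ₁² (10⁶ r² d⁻¹ log(γ₂/γ₁))^d`. [cite: KeevashLifshitz2023, Thm. 3.1] -/
theorem GlobalLevelDInequalityBiglobal.dual (h : GlobalLevelDInequalityBiglobal) :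
    ∀ (n : ℕ) (f : Equiv.Perm (Fin n) → ℝ) (r γ₁ γ₂ : ℝ) (d : ℕ) (g : SnSpace n),
      1 ≤ d → 1 < r → 0 < γ₁ → γ₁ < γ₂ → IsBiglobal r γ₁ γ₂ d f →
      (d : ℝ) ≤ Real.log (γ₂ / γ₁) / 4 → (d : ℝ) ≤ (n : ℝ) / 10 ^ 5 →
      g ∈ degLE n d → (∀ w ∈ degLE n (d - 1), ⟪g, w⟫_ℝ = 0) →
      (∑ σ, f σ * g σ) ^ 2 ≤
        ‖g‖ ^ 2 * n.factorial * (γ₁ ^ 2 * (10 ^ 6 * r ^ 2 * (1 / (d : ℝ)) * Real.log (γ₂ / γ₁)) ^ d) := by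
  intro n f r γ₁ γ₂ d g hd hr hγ₁ hγ₁₂ hf h4 hn hg hg'
  have hlev := h n f r γ₁ γ₂ d hr hγ₁ hγ₁₂ hf h4 hn
  have hcs := sq_inner_le_norm_levelPart_sq_mul hd (vec f) hg hg'
  rw [inner_vec_left] at hcs
  have hfac : (0 : ℝ) < n.factorial := by exact_mod_cast n.factorial_pos
  rw [div_le_iff₀ hfac] at hlev
  calc (∑ σ, f σ * g σ) ^ 2 ≤ ‖levelPart n d (vec f)‖ ^ 2 * ‖g‖ ^ 2 := hcs
    _ ≤ (γ₁ ^ 2 * (10 ^ 6 * r ^ 2 * (1 / (d : ℝ)) * Real.log (γ₂ / γ₁)) ^ d * n.factorial) * ‖g‖ ^ 2 := by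
        gcongr
    _ = _ := by ring

/-! ## Indicator-weighted functions `y · 1_A` are biglobal with the parameters of the set `A` -/

/-- For `|y| ≤ 1`, `Σ_{σ ∈ U} |(y1_A) σ| ≤ |A ∩ U|`. [cite: KeevashLifshitz2023, Def. 1.4] -/
private theorem sum_abs_indicator_mul_le (A U : Finset (Equiv.Perm (Fin n))) {y : Equiv.Perm (Fin n) → ℝ}
    (hy : ∀ σ, |y σ| ≤ 1) :
    (∑ σ ∈ U, |(if σ ∈ A then y σ else 0)|) ≤ ((A ∩ U).card : ℝ) := by
  calc (∑ σ ∈ U, |(if σ ∈ A then y σ else 0)|) ≤ ∑ σ ∈ U, (if σ ∈ A then (1 : ℝ) else 0) := by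
        refine sum_le_sum fun σ _ => ?_
        split_ifs with hσ
        · exact hy σ
        · simp
    _ = ((A ∩ U).card : ℝ) := by
        rw [sum_boole, filter_mem_eq_inter, inter_comm]

/-- For `|y| ≤ 1`, `Σ_{σ ∈ U} ((y1_A) σ)² ≤ |A ∩ U|`. [cite: KeevashLifshitz2023, Def. 1.4] -/
private theorem sum_sq_indicator_mul_le (A U : Finset (Equiv.Perm (Fin n))) {y : Equiv.Perm (Fin n) → ℝ}
    (hy : ∀ σ, |y σ| ≤ 1) :
    (∑ σ ∈ U, (if σ ∈ A then y σ else 0) ^ 2) ≤ ((A ∩ U).card : ℝ) := by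
  calc (∑ σ ∈ U, (if σ ∈ A then y σ else 0) ^ 2) ≤ ∑ σ ∈ U, (if σ ∈ A then (1 : ℝ) else 0) := by
        refine sum_le_sum fun σ _ => ?_
        split_ifs with hσ
        · exact (sq_le_one_iff_abs_le_one _).2 (hy σ)
        · simp
    _ = ((A ∩ U).card : ℝ) := by
        rw [sum_boole, filter_mem_eq_inter, inter_comm]

/-- **`y · 1_A` is biglobal with the parameters of `A`.** If `A ⊆ S_n` is `r`-global (Def. 1.6:
`μ_U(A) ≤ r^{2t} μ(A)` on every `t`-umvirate `U`) and `r² ≥ 1`, then for every weight `y : S_n → [−1, 1]`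
the function `y · 1_A` is `(r², μ(A), √μ(A), d)`-biglobal for every `d` (`μ(A) = |A|/n!`):
`‖(y1_A)_U‖₁ ≤ μ_U(A) ≤ (r²)^t μ(A)` and `‖(y1_A)_U‖₂² ≤ μ_U(A) ≤ r^{2t} μ(A) ≤ ((r²)^t √μ(A))²`.
[cite: KeevashLifshitz2023, Def. 1.4 ("the same terminology for a set `A`, meaning that `1_A` has the corresponding property")] -/
theorem isBiglobal_indicator_mul {r : ℝ} {A : Finset (Equiv.Perm (Fin n))} (hA : IsGlobal r A)
    (hr : 1 ≤ r ^ 2) {y : Equiv.Perm (Fin n) → ℝ} (hy : ∀ σ, |y σ| ≤ 1) (d : ℕ) :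
    IsBiglobal (r ^ 2) ((A.card : ℝ) / n.factorial) (Real.sqrt ((A.card : ℝ) / n.factorial)) d
      (fun σ => if σ ∈ A then y σ else 0) := by
  intro t _ I J hI hJ
  set U := umvirate I J
  have hfac : (0 : ℝ) < n.factorial := by exact_mod_cast n.factorial_pos
  have hμ : (0 : ℝ) ≤ (A.card : ℝ) / n.factorial := by positivity
  -- globalness of `A` on `U`: `|A ∩ U| ≤ r^{2t} μ(A) |U|`
  have hglob : ((A ∩ U).card : ℝ) ≤ r ^ (2 * t) * ((A.card : ℝ) / n.factorial) * (U.card : ℝ) := by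
    have h := hA t I J hI hJ
    rw [show r ^ (2 * t) * ((A.card : ℝ) / n.factorial) * (U.card : ℝ) =
        r ^ (2 * t) * (A.card : ℝ) * (U.card : ℝ) / n.factorial by ring]
    rwa [le_div_iff₀ hfac]
  refine ⟨(sum_abs_indicator_mul_le A U hy).trans (by rwa [← pow_mul]), ?_⟩
  refine (sum_sq_indicator_mul_le A U hy).trans (hglob.trans ?_)
  rw [mul_pow, Real.sq_sqrt hμ, ← pow_mul, pow_mul r 2 t]
  have hpow : (r ^ 2) ^ t ≤ (r ^ 2) ^ (t * 2) := pow_le_pow_right₀ hr (by omega)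
  have h0 : (0 : ℝ) ≤ ((A.card : ℝ) / n.factorial) * (U.card : ℝ) := by positivity
  nlinarith

/-! ## `r² ≥ 1` is automatic for nonempty global sets -/

/-- The `1`-umvirates `U_{i→j}`, `j ∈ [n]`, partition `S_n`: `Σ_j |A ∩ U_{i→j}| = |A|`.
[cite: KeevashLifshitz2023, §1.2 (p. 4, umvirates as cosets of point stabilisers)] -/
private theorem sum_card_inter_umvirate_one (A : Finset (Equiv.Perm (Fin n))) (i : Fin n) :
    ∑ j : Fin n, (A ∩ umvirate (fun _ : Fin 1 => i) (fun _ : Fin 1 => j)).card = A.card := by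
  rw [card_eq_sum_card_fiberwise (f := fun σ : Equiv.Perm (Fin n) => σ i) (t := univ) fun _ _ => mem_univ _]
  refine sum_congr rfl fun j _ => ?_
  congr 1
  ext σ
  simp only [mem_inter, mem_filter, mem_umvirate, forall_const]

/-- **A nonempty `r`-global set has `r² ≥ 1`**: averaging the globalness inequality
`|A ∩ U_{i→j}| · n! ≤ r² |A| |U_{i→j}|` over `j ∈ [n]` gives `|A| · n! ≤ r² |A| · n!`.
[cite: KeevashLifshitz2023, Def. 1.6] -/
theorem one_le_sq_of_isGlobal {r : ℝ} {A : Finset (Equiv.Perm (Fin n))} (hA : IsGlobal r A)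
    (hne : A.Nonempty) (hn : 1 ≤ n) : 1 ≤ r ^ 2 := by
  set i : Fin n := ⟨0, hn⟩
  have hinj : ∀ j : Fin n, Function.Injective (fun _ : Fin 1 => j) := fun _ a b _ => Subsingleton.elim a b
  have hsum : ∑ j : Fin n, ((A ∩ umvirate (fun _ : Fin 1 => i) (fun _ : Fin 1 => j)).card : ℝ) * n.factorial ≤
      ∑ j : Fin n, r ^ 2 * (A.card : ℝ) * ((umvirate (fun _ : Fin 1 => i) (fun _ : Fin 1 => j)).card : ℝ) := by
    refine sum_le_sum fun j _ => ?_
    have h := hA 1 (fun _ => i) (fun _ => j) (hinj i) (hinj j)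
    rwa [show 2 * 1 = 2 from rfl] at h
  rw [← sum_mul, ← mul_sum] at hsum
  have h1 : (∑ j : Fin n, ((A ∩ umvirate (fun _ : Fin 1 => i) (fun _ : Fin 1 => j)).card : ℝ)) = A.card := by
    exact_mod_cast sum_card_inter_umvirate_one A i
  have h2 : (∑ j : Fin n, ((umvirate (fun _ : Fin 1 => i) (fun _ : Fin 1 => j)).card : ℝ)) = n.factorial := by
    have h := sum_card_inter_umvirate_one (univ : Finset (Equiv.Perm (Fin n))) i
    simp only [univ_inter, card_univ, Fintype.card_perm, Fintype.card_fin] at h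
    exact_mod_cast h
  rw [h1, h2] at hsum
  have hpos : (0 : ℝ) < (A.card : ℝ) * n.factorial := by
    have : (0 : ℝ) < A.card := by exact_mod_cast hne.card_pos
    positivity
  nlinarith

/-! ## Theorem 1.8 from Theorem 3.1, and the weighted dual form -/

/-- `vec` of the zero function is `0`. [cite: KeevashLifshitz2023, §1.2 (p. 4)] -/
private theorem vec_indicator_empty (y : Equiv.Perm (Fin n) → ℝ) :
    vec (fun σ => if σ ∈ (∅ : Finset (Equiv.Perm (Fin n))) then y σ else 0) = 0 := by
  ext σ
  simp

/-- `0^{=d} = 0`. [cite: KeevashLifshitz2023, Def. 1.7] -/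
private theorem levelPart_zero_vec (d : ℕ) : levelPart n d (0 : SnSpace n) = 0 := by
  unfold levelPart
  split_ifs <;> simp

/-- The main estimate behind both corollaries: for `r`-global `A` with `0 < μ(A) < 1`, `|y| ≤ 1` and
`d ≤ min(⅛ log(1/μ(A)), 10⁻⁵ n)`, Theorem 3.1 applied to the `(r² + 1, μ, √μ, d)`-biglobal function `y1_A`
gives `‖(y1_A)^{=d}‖²/n! ≤ μ(A)² (2·10⁶ r⁴ d⁻¹ log(1/μ(A)))^d`. [cite: KeevashLifshitz2023, Thm. 3.1] -/
private theorem levelPart_indicator_mul_le (h : GlobalLevelDInequalityBiglobal) {r : ℝ}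
    {A : Finset (Equiv.Perm (Fin n))} (hA : IsGlobal r A) (hne : A.Nonempty) (hAu : A ≠ univ) {d : ℕ}
    {y : Equiv.Perm (Fin n) → ℝ} (hy : ∀ σ, |y σ| ≤ 1)
    (h8 : (d : ℝ) ≤ Real.log (1 / ((A.card : ℝ) / n.factorial)) / 8) (hn : (d : ℝ) ≤ (n : ℝ) / 10 ^ 5) :
    ‖levelPart n d (vec fun σ => if σ ∈ A then y σ else 0)‖ ^ 2 / n.factorial ≤
      ((A.card : ℝ) / n.factorial) ^ 2 *
        (2 * 10 ^ 6 * r ^ 4 * (1 / (d : ℝ)) * Real.log (1 / ((A.card : ℝ) / n.factorial))) ^ d := by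
  set μ : ℝ := (A.card : ℝ) / n.factorial with hμ_def
  have hfac : (0 : ℝ) < n.factorial := by exact_mod_cast n.factorial_pos
  -- `0 < μ < 1`
  have hμ0 : 0 < μ := by
    have : (0 : ℝ) < A.card := by exact_mod_cast hne.card_pos
    positivity
  have hμ1 : μ < 1 := by
    have hlt : A.card < (univ : Finset (Equiv.Perm (Fin n))).card :=
      card_lt_card ((subset_univ A).ssubset_of_ne hAu)
    rw [card_univ, Fintype.card_perm, Fintype.card_fin] at hlt
    rw [hμ_def, div_lt_one hfac]
    exact_mod_cast hlt
  -- `n ≥ 1` (otherwise `S_n` is a point and `A` would be `∅` or everything), hence `r² ≥ 1`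
  have hn1 : 1 ≤ n := by
    rcases Nat.eq_zero_or_pos n with h0 | hpos
    · exfalso
      subst h0
      apply hAu
      apply eq_univ_of_card
      have h1 : (univ : Finset (Equiv.Perm (Fin 0))).card = 1 := by simp
      have h2 : A.card ≤ 1 := h1 ▸ card_le_card (subset_univ A)
      have h3 : 0 < A.card := hne.card_pos
      rw [Fintype.card_perm, Fintype.card_fin, Nat.factorial_zero]
      omega
    · exact hpos
  have hr2 : 1 ≤ r ^ 2 := one_le_sq_of_isGlobal hA hne hn1
  -- the biglobal parameters `(ρ, μ, √μ)` with `ρ = r² + 1 > 1`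
  set ρ : ℝ := r ^ 2 + 1
  have hρ : 1 < ρ := by have := sq_nonneg r; linarith
  have hbig : IsBiglobal ρ μ (Real.sqrt μ) d (fun σ => if σ ∈ A then y σ else 0) :=
    (isBiglobal_indicator_mul hA hr2 hy d).mono (sq_nonneg r) (by linarith) hμ0.le (Real.sqrt_nonneg _) le_rfl
  have hsqrt : μ < Real.sqrt μ := by
    have h := Real.sqrt_lt_sqrt hμ0.le hμ1
    have hμs : μ = Real.sqrt μ * Real.sqrt μ := (Real.mul_self_sqrt hμ0.le).symm
    rw [Real.sqrt_one] at h
    nlinarith [Real.sqrt_nonneg μ]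
  -- `log(√μ/μ) = ½ log(1/μ)`
  have hlog : Real.log (Real.sqrt μ / μ) = Real.log (1 / μ) / 2 := by
    rw [Real.log_div (Real.sqrt_pos.2 hμ0).ne' hμ0.ne', Real.log_sqrt hμ0.le, one_div, Real.log_inv]
    ring
  have h4 : (d : ℝ) ≤ Real.log (Real.sqrt μ / μ) / 4 := by rw [hlog]; linarith
  have key := h n (fun σ => if σ ∈ A then y σ else 0) ρ μ (Real.sqrt μ) d hρ hμ0 hsqrt hbig h4 hn
  rw [hlog] at key
  refine key.trans (mul_le_mul_of_nonneg_left ?_ (sq_nonneg μ))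
  -- compare the bases: `10⁶ ρ² d⁻¹ (L/2) ≤ 2·10⁶ r⁴ d⁻¹ L` since `ρ² ≤ 4 r⁴`
  have hL : 0 ≤ Real.log (1 / μ) := Real.log_nonneg (by rw [le_div_iff₀ hμ0]; linarith)
  have hdinv : (0 : ℝ) ≤ 1 / (d : ℝ) := by positivity
  have hρ4 : ρ ^ 2 ≤ 4 * r ^ 4 := by nlinarith
  apply pow_le_pow_left₀ (by positivity)
  have : 10 ^ 6 * ρ ^ 2 * (1 / (d : ℝ)) * (Real.log (1 / μ) / 2) =
      (10 ^ 6 / 2 * ρ ^ 2) * ((1 / (d : ℝ)) * Real.log (1 / μ)) := by ring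
  rw [this, show 2 * 10 ^ 6 * r ^ 4 * (1 / (d : ℝ)) * Real.log (1 / μ) =
      (2 * 10 ^ 6 * r ^ 4) * ((1 / (d : ℝ)) * Real.log (1 / μ)) by ring]
  exact mul_le_mul_of_nonneg_right (by nlinarith) (mul_nonneg hdinv hL)

/-- **Theorem 1.8 is a special case of Theorem 3.1** (as the paper says, §3 p. 17): the named fact
`GlobalLevelDInequalityBiglobal` implies the tree's named fact `GlobalLevelDInequality`, with the absolute
constant `C = 2·10⁶` (`y ≡ 1`, `γ₁ = μ(A)`, `γ₂ = √μ(A)`, parameter `r² + 1`; the degenerate sets `A = ∅`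
and `A = S_n` by hand). So every consumer of Theorem 1.8 in the tree can be fed from Theorem 3.1.
[cite: KeevashLifshitz2023, Thm. 3.1 (and §3, "Theorem 1.8 is a special case")] -/
theorem GlobalLevelDInequality_of_biglobal (h : GlobalLevelDInequalityBiglobal) : GlobalLevelDInequality := by
  refine ⟨2 * 10 ^ 6, by norm_num, fun n A r d hA h8 hn => ?_⟩
  have hfac : (0 : ℝ) < n.factorial := by exact_mod_cast n.factorial_pos
  rcases A.eq_empty_or_nonempty with hAe | hne
  · -- `A = ∅`: both sides vanish
    subst hAe
    have h0 : indVec (∅ : Finset (Equiv.Perm (Fin n))) = 0 := by ext σ; simp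
    rw [h0, levelPart_zero_vec, norm_zero]
    simp
  by_cases hAu : A = univ
  · -- `A = S_n`: `μ = 1`, so `d = 0`, and `1_{S_n}^{=0} = 1_{S_n}`
    subst hAu
    have hcard : ((univ : Finset (Equiv.Perm (Fin n))).card : ℝ) = n.factorial := by
      rw [card_univ, Fintype.card_perm, Fintype.card_fin]
    have hμ : ((univ : Finset (Equiv.Perm (Fin n))).card : ℝ) / n.factorial = 1 := by
      rw [hcard, div_self hfac.ne']
    rw [hμ] at h8 ⊢
    have hd0 : d = 0 := by
      have : (d : ℝ) ≤ 0 := by simpa using h8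
      exact_mod_cast le_antisymm this (Nat.cast_nonneg d)
    subst hd0
    rw [levelPart_zero_indVec, hμ, one_smul, norm_indVec_sq, hcard, div_self hfac.ne']
    simp
  · -- generic case `0 < μ(A) < 1`: Theorem 3.1 for `1_A = 1 · 1_A`
    have key := levelPart_indicator_mul_le h hA hne hAu (y := fun _ => 1) (fun _ => by simp) h8 hn
    exact key

/-- **Weighted consumer form (the twin of `GlobalLevelDInequality.dual` for `[−1,1]`-weights).** For an
`r`-global `A ⊆ S_n`, a weight `y : S_n → [−1, 1]`, `1 ≤ d ≤ min(⅛ log(1/μ(A)), 10⁻⁵ n)` and every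
`g ∈ V_{≤ d}` orthogonal to `V_{≤ d−1}`:
`(Σ_{σ ∈ A} y σ · g σ)² ≤ ‖g‖² · n! · μ(A)² · (2·10⁶ r⁴ d⁻¹ log(1/μ(A)))^d` — the SAME shape as the set
version, uniformly in the weight. [cite: KeevashLifshitz2023, Thm. 3.1] -/
theorem GlobalLevelDInequalityBiglobal.dual_indicator_mul (h : GlobalLevelDInequalityBiglobal) :
    ∀ (n : ℕ) (A : Finset (Equiv.Perm (Fin n))) (r : ℝ) (d : ℕ) (y : Equiv.Perm (Fin n) → ℝ) (g : SnSpace n),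
      1 ≤ d → IsGlobal r A → (∀ σ, |y σ| ≤ 1) →
      (d : ℝ) ≤ Real.log (1 / ((A.card : ℝ) / n.factorial)) / 8 →
      (d : ℝ) ≤ (n : ℝ) / 10 ^ 5 →
      g ∈ degLE n d → (∀ w ∈ degLE n (d - 1), ⟪g, w⟫_ℝ = 0) →
      (∑ σ ∈ A, y σ * g σ) ^ 2 ≤
        ‖g‖ ^ 2 * n.factorial * (((A.card : ℝ) / n.factorial) ^ 2 *
          (2 * 10 ^ 6 * r ^ 4 * (1 / (d : ℝ)) * Real.log (1 / ((A.card : ℝ) / n.factorial))) ^ d) := by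
  intro n A r d y g hd hA hy h8 hn hg hg'
  have hfac : (0 : ℝ) < n.factorial := by exact_mod_cast n.factorial_pos
  -- the weighted sum is `⟪vec (y1_A), g⟫`
  have hsum : (∑ σ ∈ A, y σ * g σ) = ∑ σ, (if σ ∈ A then y σ else 0) * g σ := by
    simp only [ite_mul, zero_mul]
    rw [sum_ite_mem, univ_inter]
  rcases A.eq_empty_or_nonempty with hAe | hne
  · subst hAe
    simp
  by_cases hAu : A = univ
  · -- `μ = 1` contradicts `1 ≤ d ≤ ⅛ log 1 = 0`
    exfalso
    subst hAu
    have hμ : ((univ : Finset (Equiv.Perm (Fin n))).card : ℝ) / n.factorial = 1 := by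
      rw [card_univ, Fintype.card_perm, Fintype.card_fin, div_self hfac.ne']
    rw [hμ] at h8
    have : (d : ℝ) ≤ 0 := by simpa using h8
    have : (1 : ℝ) ≤ d := by exact_mod_cast hd
    linarith
  · have hlev := levelPart_indicator_mul_le h hA hne hAu hy h8 hn
    have hcs := sq_inner_le_norm_levelPart_sq_mul hd (vec fun σ => if σ ∈ A then y σ else 0) hg hg'
    rw [inner_vec_left] at hcs
    rw [div_le_iff₀ hfac] at hlev
    rw [hsum]
    calc (∑ σ, (if σ ∈ A then y σ else 0) * g σ) ^ 2
        ≤ ‖levelPart n d (vec fun σ => if σ ∈ A then y σ else 0)‖ ^ 2 * ‖g‖ ^ 2 := hcs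
      _ ≤ (((A.card : ℝ) / n.factorial) ^ 2 *
            (2 * 10 ^ 6 * r ^ 4 * (1 / (d : ℝ)) * Real.log (1 / ((A.card : ℝ) / n.factorial))) ^ d *
            n.factorial) * ‖g‖ ^ 2 := by gcongr
      _ = _ := by ring

end Literature.Combinatorics.Additive.KeevashLifshitz
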